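import Summits.CriticalPhenomena.PercolationContinuityZ3.Theorems.PercNearOneGluingNoHeavyLowerTailKNGoodGMgcBoundaryTools
import HarnessLib

/-!
# THEOREM B's certificates on the CLOSED box: the factor `D_j` removed
# (`NoHeavyLowerTail` cell, stmt-CriticalPhenomena-4575; prover `prim-hp-2`, gen 19 — step S4/L6 of the semantic layer,
# memo `run/shared/lean/prim/prim-hp-2/MEMO-gen17-lean-certificates.md` §4, §4')

Support file (`--supports stmt-CriticalPhenomena-4575`; imports the COMPUTATIONAL certificate layer).  No definitions, no named facts, no sorries.
`KNGoodGMgc.certificate_j1/j2/j3` give `0 ≤ D_j(x)·Σ_v Φ_v(j;r)(x) v_v` under the cone rows and the two loneliness rows of `j`, with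
`D₁ = Q₁₂Q₁₃`, `D₂ = Q₁₂Q₂₃(Q_d+Q₂₃)`, `D₃ = Q₁₂Q₁₃Q₂₃(Q_d+Q₂₃)`.  Here the factor is removed for EVERY `x ∈ [0,1]¹²`:
* **`free_j1`**, **`free_j2`**, **`free_j3`** — `0 ≤ Σ_v Φ_v(j;r)(x) v_v` under the same hypotheses (`free_j3` also uses the cone row `−β ≤ ε`,
  `KNGoodGain.gain_bystander_le_of_le_bystander`).
Proof.  MAIN CASE (`Q_d+Q₂₃ > 0`, resp. `Q₁₃ > 0`, resp. `Q₁₂ > 0`): move `v` by `s > 0` along a cone direction that makes both rows STRICT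
(`(1,1,0,1,−1)`, resp. `e_γ`, resp. `e_ε`), move `x` along `xline x η` into the open box where `D_j > 0` (`worldQ_pos_of_interior`) while the
rows stay positive, apply the certificate there, let `η → 0` (`nonneg_at_zero_of_pos`) and then `s → 0` (`nonneg_of_forall_pos_add`).
CORNER (the complementary degenerate world law): the rows force the surviving scalars to vanish or have a sign, and every coefficient whose
worlds carry no mass vanishes by DOMINATION (`phiCoef_eq_zero_of_dom` with the table `domAll_all`); the rest is the sign pattern of
`Φ(j;r)` and, for `j = 2`, the bilinear condition (B2a).
-/

noncomputable section

namespace Summit.CriticalPhenomena.PercolationContinuityZ3.Theorems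

namespace KNGoodGMgc

open SBTens
open scoped Classical

/-! ## Small helpers -/

/-- The thirteen domination instances at a configuration. [this work] -/
theorem dom_of (r : ℕ) (hr : r = 1 ∨ r = 2 ∨ r = 3) (c : Cfg) :
    domOK 1 r 0 [0] (trunc c) = true ∧ domOK 1 r 1 [0] (trunc c) = true ∧ domOK 1 r 2 [5] (trunc c) = true ∧
    domOK 1 r 3 [0, 6] (trunc c) = true ∧ domOK 1 r 4 [3] (trunc c) = true ∧
    domOK 2 r 0 [0] (trunc c) = true ∧ domOK 2 r 3 [6] (trunc c) = true ∧ domOK 2 r 4 [3] (trunc c) = true ∧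
    domOK 3 r 0 [0] (trunc c) = true ∧ domOK 3 r 1 [0] (trunc c) = true ∧ domOK 3 r 2 [5] (trunc c) = true ∧
    domOK 3 r 3 [6] (trunc c) = true ∧ domOK 3 r 4 [0, 3] (trunc c) = true := by
  have h := domAll_of r hr c
  simp only [domAll, Bool.and_eq_true, and_assoc] at h
  exact h

/-- `Q_d + Q₁₂` as one expectation. [this work] -/
theorem bexp_qHat_d12 (x : ℕ → ℝ) : bexp 12 (qHat [0, 3]) x = worldQ 0 x + worldQ 3 x := by
  have : qHat [0, 3] = fun c => qHat [0] c + qHat [3] c := by funext c; exact qHat_pair 0 3 (by norm_num) c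
  rw [this, bexp_add]; rfl

/-- A world law that is not positive vanishes. [this work] -/
theorem worldQ_eq_zero_of_not_pos (π : ℕ) (x : ℕ → ℝ) (hx : ∀ i, 0 ≤ x i ∧ x i ≤ 1) (h : ¬0 < worldQ π x) : worldQ π x = 0 :=
  le_antisymm (not_lt.1 h) (worldQ_nonneg π x hx)

/-- Continuity of a target coefficient along the line. [this work] -/
theorem continuous_phiCoef_xline (j r : ℕ) (v : Fin 5) (x : ℕ → ℝ) : Continuous fun η : ℝ => phiCoef j r v (xline x η) :=
  continuous_bexp_xline x 11 _

/-- Continuity of a world law along the line. [this work] -/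
theorem continuous_worldQ_xline (π : ℕ) (x : ℕ → ℝ) : Continuous fun η : ℝ => worldQ π (xline x η) :=
  continuous_bexp_xline x 12 _

/-- `D > 0` inside: products of world laws along the line are positive for `η ∈ (0,1]`. [this work] -/
theorem worldQ_xline_pos (π : ℕ) (hπ : π = 0 ∨ π = 3 ∨ π = 5 ∨ π = 6) (x : ℕ → ℝ) (hx : ∀ i, 0 ≤ x i ∧ x i ≤ 1)
    (η : ℝ) (h0 : 0 < η) (h1 : η ≤ 1) : 0 < worldQ π (xline x η) :=
  worldQ_pos_of_interior π hπ _ (xline_mem x hx η h0.le h1) (fun k _ => xline_interior x hx η h0 h1 k)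

/-! ## `j = 1` -/

/-- **THEOREM B's certificate at `j = 1` on the closed box.** [this work] -/
theorem free_j1 (r : ℕ) (hr : r = 1 ∨ r = 2 ∨ r = 3) (x : ℕ → ℝ) (hx : ∀ i, 0 ≤ x i ∧ x i ≤ 1)
    (α β γ δ ε : ℝ) (hα : 0 ≤ α) (hβ : 0 ≤ β) (hδ : α ≤ δ)
    (h2 : 0 ≤ worldQ 0 x * α - worldQ 5 x * γ + worldQ 6 x * δ)
    (h3 : 0 ≤ worldQ 0 x * (α + β) - worldQ 3 x * ε + worldQ 6 x * δ) :
    0 ≤ phiCoef 1 r 0 x * α + phiCoef 1 r 1 x * β + phiCoef 1 r 2 x * γ + phiCoef 1 r 3 x * δ + phiCoef 1 r 4 x * ε := by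
  have hQ0 := worldQ_nonneg 0 x hx; have hQ3 := worldQ_nonneg 3 x hx
  have hQ5 := worldQ_nonneg 5 x hx; have hQ6 := worldQ_nonneg 6 x hx
  have hsg : phiCoef 1 r 2 x ≤ 0 := by
    rcases hr with rfl | rfl | rfl
    · exact bexp_nonpos_of_check 11 _ sg_1_1 x hx
    · exact bexp_nonpos_of_check 11 _ sg_1_2 x hx
    · exact bexp_nonpos_of_check 11 _ sg_1_3 x hx
  have hse : phiCoef 1 r 4 x ≤ 0 := by
    rcases hr with rfl | rfl | rfl
    · exact bexp_nonpos_of_check 11 _ se_1_1 x hx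
    · exact bexp_nonpos_of_check 11 _ se_1_2 x hx
    · exact bexp_nonpos_of_check 11 _ se_1_3 x hx
  by_cases hQ : 0 < worldQ 0 x + worldQ 6 x
  · -- MAIN CASE: perturb `v` along `(1,1,0,1,-1)` and `x` into the interior
    apply nonneg_of_forall_pos_add _ (phiCoef 1 r 0 x + phiCoef 1 r 1 x + phiCoef 1 r 3 x - phiCoef 1 r 4 x)
    intro s hs
    have key := nonneg_at_zero_of_pos
      (fun η => phiCoef 1 r 0 (xline x η) * (α + s) + phiCoef 1 r 1 (xline x η) * (β + s) + phiCoef 1 r 2 (xline x η) * γ +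
        phiCoef 1 r 3 (xline x η) * (δ + s) + phiCoef 1 r 4 (xline x η) * (ε - s))
      (fun η => worldQ 3 (xline x η) * worldQ 5 (xline x η))
      (fun η => worldQ 0 (xline x η) * (α + s) - worldQ 5 (xline x η) * γ + worldQ 6 (xline x η) * (δ + s))
      (fun η => worldQ 0 (xline x η) * (α + s + (β + s)) - worldQ 3 (xline x η) * (ε - s) + worldQ 6 (xline x η) * (δ + s))
      ((((((continuous_phiCoef_xline 1 r 0 x).mul continuous_const).add
        ((continuous_phiCoef_xline 1 r 1 x).mul continuous_const)).add
        ((continuous_phiCoef_xline 1 r 2 x).mul continuous_const)).add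
        ((continuous_phiCoef_xline 1 r 3 x).mul continuous_const)).add
        ((continuous_phiCoef_xline 1 r 4 x).mul continuous_const))
      ((((continuous_worldQ_xline 0 x).mul continuous_const).sub ((continuous_worldQ_xline 5 x).mul continuous_const)).add
        ((continuous_worldQ_xline 6 x).mul continuous_const))
      ((((continuous_worldQ_xline 0 x).mul continuous_const).sub ((continuous_worldQ_xline 3 x).mul continuous_const)).add
        ((continuous_worldQ_xline 6 x).mul continuous_const))
      (fun η h0 h1 => mul_pos (worldQ_xline_pos 3 (by norm_num) x hx η h0 h1) (worldQ_xline_pos 5 (by norm_num) x hx η h0 h1))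
      (fun η h0 h1 r2 r3 => certificate_j1 r hr (xline x η) (xline_mem x hx η h0 h1) (α + s) (β + s) γ (δ + s) (ε - s)
        (by linarith) (by linarith) (by linarith) r2 r3)
      (by simp only [xline_zero]; nlinarith [mul_pos hs hQ])
      (by simp only [xline_zero]; nlinarith [mul_pos hs hQ])
    simp only [xline_zero] at key
    have e : phiCoef 1 r 0 x * (α + s) + phiCoef 1 r 1 x * (β + s) + phiCoef 1 r 2 x * γ + phiCoef 1 r 3 x * (δ + s) +
        phiCoef 1 r 4 x * (ε - s) =
        phiCoef 1 r 0 x * α + phiCoef 1 r 1 x * β + phiCoef 1 r 2 x * γ + phiCoef 1 r 3 x * δ + phiCoef 1 r 4 x * ε +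
          s * (phiCoef 1 r 0 x + phiCoef 1 r 1 x + phiCoef 1 r 3 x - phiCoef 1 r 4 x) := by ring
    rw [e] at key; exact key
  · -- CORNER: `Q_d = Q₂₃ = 0`
    have hQ0' : worldQ 0 x = 0 := by linarith
    have hQ6' : worldQ 6 x = 0 := by linarith
    have dz := fun c => dom_of r hr c
    have h06 : bexp 12 (qHat [0, 6]) x = 0 := by rw [bexp_qHat_d23, hQ0', hQ6', add_zero]
    have hα0 : phiCoef 1 r 0 x = 0 := phiCoef_eq_zero_of_dom 1 r 0 [0] (fun c => (dz c).1) x hx hQ0'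
    have hβ0 : phiCoef 1 r 1 x = 0 := phiCoef_eq_zero_of_dom 1 r 1 [0] (fun c => (dz c).2.1) x hx hQ0'
    have hδ0 : phiCoef 1 r 3 x = 0 := phiCoef_eq_zero_of_dom 1 r 3 [0, 6] (fun c => (dz c).2.2.2.1) x hx h06
    rw [hQ0', hQ6'] at h2 h3
    have hγt : 0 ≤ phiCoef 1 r 2 x * γ := by
      by_cases h5 : 0 < worldQ 5 x
      · have hγ : γ ≤ 0 := by
          by_contra hγ; push Not at hγ; nlinarith [mul_pos h5 hγ]
        nlinarith [hsg, hγ]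
      · rw [phiCoef_eq_zero_of_dom 1 r 2 [5] (fun c => (dz c).2.2.1) x hx (worldQ_eq_zero_of_not_pos 5 x hx h5), zero_mul]
    have hεt : 0 ≤ phiCoef 1 r 4 x * ε := by
      by_cases h3' : 0 < worldQ 3 x
      · have hε : ε ≤ 0 := by
          by_contra hε; push Not at hε; nlinarith [mul_pos h3' hε]
        nlinarith [hse, hε]
      · rw [phiCoef_eq_zero_of_dom 1 r 4 [3] (fun c => (dz c).2.2.2.2.1) x hx (worldQ_eq_zero_of_not_pos 3 x hx h3'), zero_mul]
    rw [hα0, hβ0, hδ0]; linarith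

/-! ## `j = 2` -/

/-- **THEOREM B's certificate at `j = 2` on the closed box.** [this work] -/
theorem free_j2 (r : ℕ) (hr : r = 1 ∨ r = 2 ∨ r = 3) (x : ℕ → ℝ) (hx : ∀ i, 0 ≤ x i ∧ x i ≤ 1)
    (α β γ δ ε : ℝ) (hα : 0 ≤ α) (hβ : 0 ≤ β) (hγ : 0 ≤ γ) (hδ : α ≤ δ)
    (h1 : 0 ≤ -worldQ 0 x * α + worldQ 5 x * γ - worldQ 6 x * δ)
    (h3 : 0 ≤ worldQ 0 x * β - worldQ 3 x * ε + worldQ 5 x * γ) :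
    0 ≤ phiCoef 2 r 0 x * α + phiCoef 2 r 1 x * β + phiCoef 2 r 2 x * γ + phiCoef 2 r 3 x * δ + phiCoef 2 r 4 x * ε := by
  have hQ0 := worldQ_nonneg 0 x hx; have hQ3 := worldQ_nonneg 3 x hx
  have hQ5 := worldQ_nonneg 5 x hx; have hQ6 := worldQ_nonneg 6 x hx
  have hse : phiCoef 2 r 4 x ≤ 0 := by
    rcases hr with rfl | rfl | rfl
    · exact bexp_nonpos_of_check 11 _ se_2_1 x hx
    · exact bexp_nonpos_of_check 11 _ se_2_2 x hx
    · exact bexp_nonpos_of_check 11 _ se_2_3 x hx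
  have hsb := phiCoef_beta_two_nonneg r hr x hx
  have hsgp := phiCoef_gamma_two_nonneg r hr x hx
  by_cases hQ : 0 < worldQ 5 x
  · -- MAIN CASE: perturb `γ`
    apply nonneg_of_forall_pos_add _ (phiCoef 2 r 2 x)
    intro s hs
    have key := nonneg_at_zero_of_pos
      (fun η => phiCoef 2 r 0 (xline x η) * α + phiCoef 2 r 1 (xline x η) * β + phiCoef 2 r 2 (xline x η) * (γ + s) +
        phiCoef 2 r 3 (xline x η) * δ + phiCoef 2 r 4 (xline x η) * ε)
      (fun η => worldQ 3 (xline x η) * worldQ 6 (xline x η) * (worldQ 0 (xline x η) + worldQ 6 (xline x η)))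
      (fun η => -worldQ 0 (xline x η) * α + worldQ 5 (xline x η) * (γ + s) - worldQ 6 (xline x η) * δ)
      (fun η => worldQ 0 (xline x η) * β - worldQ 3 (xline x η) * ε + worldQ 5 (xline x η) * (γ + s))
      ((((((continuous_phiCoef_xline 2 r 0 x).mul continuous_const).add
        ((continuous_phiCoef_xline 2 r 1 x).mul continuous_const)).add
        ((continuous_phiCoef_xline 2 r 2 x).mul continuous_const)).add
        ((continuous_phiCoef_xline 2 r 3 x).mul continuous_const)).add
        ((continuous_phiCoef_xline 2 r 4 x).mul continuous_const))
      ((((continuous_worldQ_xline 0 x).neg.mul continuous_const).add ((continuous_worldQ_xline 5 x).mul continuous_const)).sub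
        ((continuous_worldQ_xline 6 x).mul continuous_const))
      ((((continuous_worldQ_xline 0 x).mul continuous_const).sub ((continuous_worldQ_xline 3 x).mul continuous_const)).add
        ((continuous_worldQ_xline 5 x).mul continuous_const))
      (fun η h0 h1 => mul_pos (mul_pos (worldQ_xline_pos 3 (by norm_num) x hx η h0 h1) (worldQ_xline_pos 6 (by norm_num) x hx η h0 h1))
        (by have := worldQ_xline_pos 0 (by norm_num) x hx η h0 h1
            have := worldQ_xline_pos 6 (by norm_num) x hx η h0 h1; linarith))
      (fun η h0 h1 r1 r3 => certificate_j2 r hr (xline x η) (xline_mem x hx η h0 h1) α β (γ + s) δ ε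
        hα hβ (by linarith) hδ r1 r3)
      (by simp only [xline_zero]; nlinarith [mul_pos hs hQ])
      (by simp only [xline_zero]; nlinarith [mul_pos hs hQ])
    simp only [xline_zero] at key
    have e : phiCoef 2 r 0 x * α + phiCoef 2 r 1 x * β + phiCoef 2 r 2 x * (γ + s) + phiCoef 2 r 3 x * δ + phiCoef 2 r 4 x * ε =
        phiCoef 2 r 0 x * α + phiCoef 2 r 1 x * β + phiCoef 2 r 2 x * γ + phiCoef 2 r 3 x * δ + phiCoef 2 r 4 x * ε +
          s * phiCoef 2 r 2 x := by ring
    rw [e] at key; exact key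
  · -- CORNER: `Q₁₃ = 0`
    have hQ5' : worldQ 5 x = 0 := worldQ_eq_zero_of_not_pos 5 x hx hQ
    have dz := fun c => dom_of r hr c
    rw [hQ5'] at h1 h3
    have hδ0 : 0 ≤ δ := le_trans hα hδ
    have hQ0α : worldQ 0 x * α = 0 := by nlinarith [mul_nonneg hQ0 hα, mul_nonneg hQ6 hδ0]
    have hQ6δ : worldQ 6 x * δ = 0 := by nlinarith [mul_nonneg hQ0 hα, mul_nonneg hQ6 hδ0]
    have hαt : phiCoef 2 r 0 x * α = 0 := by
      by_cases h0 : 0 < worldQ 0 x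
      · have : α = 0 := by
          rcases mul_eq_zero.1 hQ0α with h | h
          · exact absurd h (ne_of_gt h0)
          · exact h
        rw [this, mul_zero]
      · rw [phiCoef_eq_zero_of_dom 2 r 0 [0] (fun c => (dz c).2.2.2.2.2.1) x hx (worldQ_eq_zero_of_not_pos 0 x hx h0), zero_mul]
    have hδt : phiCoef 2 r 3 x * δ = 0 := by
      by_cases h6 : 0 < worldQ 6 x
      · have : δ = 0 := by
          rcases mul_eq_zero.1 hQ6δ with h | h
          · exact absurd h (ne_of_gt h6)
          · exact h
        rw [this, mul_zero]
      · rw [phiCoef_eq_zero_of_dom 2 r 3 [6] (fun c => (dz c).2.2.2.2.2.2.1) x hx (worldQ_eq_zero_of_not_pos 6 x hx h6), zero_mul]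
    have hγt : 0 ≤ phiCoef 2 r 2 x * γ := mul_nonneg hsgp hγ
    have hβε : 0 ≤ phiCoef 2 r 1 x * β + phiCoef 2 r 4 x * ε := by
      by_cases hε : ε ≤ 0
      · nlinarith [mul_nonneg hsb hβ, hse, hε]
      · push Not at hε
        by_cases h3' : 0 < worldQ 3 x
        · -- (B2a): `0 ≤ Φ_β Q₁₂ + Φ_ε Q_d`
          obtain ⟨Ba, -⟩ := theoremB_certificates 2 r (Or.inr (Or.inl rfl)) hr false x hx
          change 0 ≤ phiCoef 2 r 1 x * worldQ 3 x + phiCoef 2 r 4 x * worldQ 0 x at Ba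
          have hle : worldQ 3 x * ε ≤ worldQ 0 x * β := by linarith
          have t1 : phiCoef 2 r 4 x * (worldQ 0 x * β) ≤ phiCoef 2 r 4 x * (worldQ 3 x * ε) :=
            mul_le_mul_of_nonpos_left hle hse
          have t2 : 0 ≤ worldQ 3 x * (phiCoef 2 r 1 x * β + phiCoef 2 r 4 x * ε) := by nlinarith [mul_nonneg hβ Ba]
          exact le_of_mul_le_mul_left (by simpa using t2) h3'
        · rw [phiCoef_eq_zero_of_dom 2 r 4 [3] (fun c => (dz c).2.2.2.2.2.2.2.1) x hx (worldQ_eq_zero_of_not_pos 3 x hx h3'),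
            zero_mul, add_zero]
          exact mul_nonneg hsb hβ
    linarith

/-! ## `j = 3` -/

/-- **THEOREM B's certificate at `j = 3` on the closed box** (uses also the cone row `−β ≤ ε`). [this work] -/
theorem free_j3 (r : ℕ) (hr : r = 1 ∨ r = 2 ∨ r = 3) (x : ℕ → ℝ) (hx : ∀ i, 0 ≤ x i ∧ x i ≤ 1)
    (α β γ δ ε : ℝ) (hα : 0 ≤ α) (hβ : 0 ≤ β) (hγ : 0 ≤ γ) (hδ : α ≤ δ) (hε : -β ≤ ε)
    (h1 : 0 ≤ -worldQ 0 x * (α + β) + worldQ 3 x * ε - worldQ 6 x * δ)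
    (h2 : 0 ≤ -worldQ 0 x * β + worldQ 3 x * ε - worldQ 5 x * γ) :
    0 ≤ phiCoef 3 r 0 x * α + phiCoef 3 r 1 x * β + phiCoef 3 r 2 x * γ + phiCoef 3 r 3 x * δ + phiCoef 3 r 4 x * ε := by
  have hQ0 := worldQ_nonneg 0 x hx; have hQ3 := worldQ_nonneg 3 x hx
  have hQ5 := worldQ_nonneg 5 x hx; have hQ6 := worldQ_nonneg 6 x hx
  have hsep := phiCoef_eps_three_nonneg r hr x hx
  by_cases hQ : 0 < worldQ 3 x
  · -- MAIN CASE: perturb `ε`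
    apply nonneg_of_forall_pos_add _ (phiCoef 3 r 4 x)
    intro s hs
    have key := nonneg_at_zero_of_pos
      (fun η => phiCoef 3 r 0 (xline x η) * α + phiCoef 3 r 1 (xline x η) * β + phiCoef 3 r 2 (xline x η) * γ +
        phiCoef 3 r 3 (xline x η) * δ + phiCoef 3 r 4 (xline x η) * (ε + s))
      (fun η => worldQ 3 (xline x η) * worldQ 5 (xline x η) * worldQ 6 (xline x η) * (worldQ 0 (xline x η) + worldQ 6 (xline x η)))
      (fun η => -worldQ 0 (xline x η) * (α + β) + worldQ 3 (xline x η) * (ε + s) - worldQ 6 (xline x η) * δ)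
      (fun η => -worldQ 0 (xline x η) * β + worldQ 3 (xline x η) * (ε + s) - worldQ 5 (xline x η) * γ)
      ((((((continuous_phiCoef_xline 3 r 0 x).mul continuous_const).add
        ((continuous_phiCoef_xline 3 r 1 x).mul continuous_const)).add
        ((continuous_phiCoef_xline 3 r 2 x).mul continuous_const)).add
        ((continuous_phiCoef_xline 3 r 3 x).mul continuous_const)).add
        ((continuous_phiCoef_xline 3 r 4 x).mul continuous_const))
      ((((continuous_worldQ_xline 0 x).neg.mul continuous_const).add ((continuous_worldQ_xline 3 x).mul continuous_const)).sub
        ((continuous_worldQ_xline 6 x).mul continuous_const))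
      ((((continuous_worldQ_xline 0 x).neg.mul continuous_const).add ((continuous_worldQ_xline 3 x).mul continuous_const)).sub
        ((continuous_worldQ_xline 5 x).mul continuous_const))
      (fun η h0 h1 => mul_pos (mul_pos (mul_pos (worldQ_xline_pos 3 (by norm_num) x hx η h0 h1)
          (worldQ_xline_pos 5 (by norm_num) x hx η h0 h1)) (worldQ_xline_pos 6 (by norm_num) x hx η h0 h1))
        (by have := worldQ_xline_pos 0 (by norm_num) x hx η h0 h1
            have := worldQ_xline_pos 6 (by norm_num) x hx η h0 h1; linarith))
      (fun η h0 h1 r1 r2 => certificate_j3 r hr (xline x η) (xline_mem x hx η h0 h1) α β γ δ (ε + s)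
        hα hβ hγ hδ r1 r2)
      (by simp only [xline_zero]; nlinarith [mul_pos hs hQ])
      (by simp only [xline_zero]; nlinarith [mul_pos hs hQ])
    simp only [xline_zero] at key
    have e : phiCoef 3 r 0 x * α + phiCoef 3 r 1 x * β + phiCoef 3 r 2 x * γ + phiCoef 3 r 3 x * δ + phiCoef 3 r 4 x * (ε + s) =
        phiCoef 3 r 0 x * α + phiCoef 3 r 1 x * β + phiCoef 3 r 2 x * γ + phiCoef 3 r 3 x * δ + phiCoef 3 r 4 x * ε +
          s * phiCoef 3 r 4 x := by ring
    rw [e] at key; exact key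
  · -- CORNER: `Q₁₂ = 0`
    have hQ3' : worldQ 3 x = 0 := worldQ_eq_zero_of_not_pos 3 x hx hQ
    have dz := fun c => dom_of r hr c
    rw [hQ3'] at h1 h2
    have hδ0 : 0 ≤ δ := le_trans hα hδ
    have hQ0α : worldQ 0 x * α = 0 := by nlinarith [mul_nonneg hQ0 hα, mul_nonneg hQ0 hβ, mul_nonneg hQ6 hδ0]
    have hQ0β : worldQ 0 x * β = 0 := by nlinarith [mul_nonneg hQ0 hα, mul_nonneg hQ0 hβ, mul_nonneg hQ6 hδ0]
    have hQ6δ : worldQ 6 x * δ = 0 := by nlinarith [mul_nonneg hQ0 hα, mul_nonneg hQ0 hβ, mul_nonneg hQ6 hδ0]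
    have hQ5γ : worldQ 5 x * γ = 0 := by nlinarith [mul_nonneg hQ0 hβ, mul_nonneg hQ5 hγ]
    have hαt : phiCoef 3 r 0 x * α = 0 := by
      by_cases h0 : 0 < worldQ 0 x
      · rcases mul_eq_zero.1 hQ0α with h | h
        · exact absurd h (ne_of_gt h0)
        · rw [h, mul_zero]
      · rw [phiCoef_eq_zero_of_dom 3 r 0 [0] (fun c => (dz c).2.2.2.2.2.2.2.2.1) x hx (worldQ_eq_zero_of_not_pos 0 x hx h0), zero_mul]
    have hβt : phiCoef 3 r 1 x * β = 0 := by
      by_cases h0 : 0 < worldQ 0 x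
      · rcases mul_eq_zero.1 hQ0β with h | h
        · exact absurd h (ne_of_gt h0)
        · rw [h, mul_zero]
      · rw [phiCoef_eq_zero_of_dom 3 r 1 [0] (fun c => (dz c).2.2.2.2.2.2.2.2.2.1) x hx (worldQ_eq_zero_of_not_pos 0 x hx h0),
          zero_mul]
    have hγt : phiCoef 3 r 2 x * γ = 0 := by
      by_cases h5 : 0 < worldQ 5 x
      · rcases mul_eq_zero.1 hQ5γ with h | h
        · exact absurd h (ne_of_gt h5)
        · rw [h, mul_zero]
      · rw [phiCoef_eq_zero_of_dom 3 r 2 [5] (fun c => (dz c).2.2.2.2.2.2.2.2.2.2.1) x hx (worldQ_eq_zero_of_not_pos 5 x hx h5),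
          zero_mul]
    have hδt : phiCoef 3 r 3 x * δ = 0 := by
      by_cases h6 : 0 < worldQ 6 x
      · rcases mul_eq_zero.1 hQ6δ with h | h
        · exact absurd h (ne_of_gt h6)
        · rw [h, mul_zero]
      · rw [phiCoef_eq_zero_of_dom 3 r 3 [6] (fun c => (dz c).2.2.2.2.2.2.2.2.2.2.2.1) x hx (worldQ_eq_zero_of_not_pos 6 x hx h6),
          zero_mul]
    have hεt : 0 ≤ phiCoef 3 r 4 x * ε := by
      by_cases h0 : 0 < worldQ 0 x
      · have hβ0 : β = 0 := by
          rcases mul_eq_zero.1 hQ0β with h | h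
          · exact absurd h (ne_of_gt h0)
          · exact h
        have : 0 ≤ ε := by rw [hβ0] at hε; linarith
        exact mul_nonneg hsep this
      · have h03 : bexp 12 (qHat [0, 3]) x = 0 := by rw [bexp_qHat_d12, worldQ_eq_zero_of_not_pos 0 x hx h0, hQ3', add_zero]
        rw [phiCoef_eq_zero_of_dom 3 r 4 [0, 3] (fun c => (dz c).2.2.2.2.2.2.2.2.2.2.2.2) x hx h03, zero_mul]
    linarith

end KNGoodGMgc

end Summit.CriticalPhenomena.PercolationContinuityZ3.Theorems

end
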